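import Mathlib
import HarnessLib
import Literature.Probability.MarkovChains.NashInequality
import Literature.Probability.MarkovChains.CheegerInequality

/-!
# Faber–Krahn bounds from log-Sobolev and Nash inequalities: `λ₀(A) ≥ ρ log(1/π(A))/(1 − π(A))·` (on `Var`) and `λ₀(A) ≥ 1/(Cπ(A)^{2/d}) − 1/T` (Goel–Montenegro–Tetali 2006, Lemmas 4.2–4.3), with `Var_π(f) ≤ Ent_π(f²)` for `f ≥ 0`

HONEST FRAMING: exact (Metropolis-corrected) sampling algorithms for lattice gauge theory; figures
of merit are autocorrelation/cost numbers at stated couplings and volumes; no continuum-physics claim.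

Source (READ on the hub's materialised text, §4.2 "Log-Sobolev and Nash Inequalities", pp. 9–10):
S. Goel, R. Montenegro, P. Tetali, *Mixing time bounds via the spectral profile*, Electron. J.
Probab. **11** (2006) 1–26 = math.PR/0505690 [GoelMontenegroTetali2006]: DEFINITION 4.1 (the
log-Sobolev constant `ρ = inf 𝓔(f,f)/Ent_π f²`, `Ent_π(f²) = Σ f² log(f²/‖f‖₂²)π` — the tree's
`logSobolevConst π K` / `entForm π f` of `LogSobolevConstant.lean`), LEMMA 4.2 (`Λ(r) ≥ ρ log(1/r)/
(1 − r)`) with its proof ("Define `π' = π/π(S)` on `S` … Rearranging the terms, it suffices to show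
that `inf Ent_{π'}(f²)/Var_{π'}(f) ≥ π(S)log(1/π(S))/(1 − π(S))`. However … `π(S)log(1/π(S))/(1 − π(S))
≤ 1` and so it suffices that for every probability measure and `f ≥ 0` that `Ent(f²)/Var(f) ≥ 1`.
This is true, as observed in [LO00] and recalled in Remark 6.7 of [BT03]"), and LEMMA 4.3 (given
the Nash inequality `‖f‖₂^{2+1/D} ≤ C[𝓔(f,f) + ‖f‖₂²/T]‖f‖₁^{1/D}`, `Λ(r) ≥ 1/(Cr^{1/2D}) − 1/T`)
with its proof ("`λ₀(A) = inf_{c₀(A)} 𝓔/‖f‖₂² ≥ inf (1/C)(‖f‖₂/‖f‖₁)^{1/D} − 1/T ≥ 1/(Cπ(A)^{1/2D})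
− 1/T`. The final inequality was due to Cauchy–Schwartz: `‖f‖₁ ≤ ‖f‖₂√π(supp f)`").
Everything is PROVED (finite sums; 0 named facts), including the quoted external step
`Var(f) ≤ Ent(f²)` (`f ≥ 0`), here by the two-line argument `u²log(u²/a²) ≥ 2u² − 2au` (`log v ≥
1 − 1/v`) summed with `a² = E f²`: `Ent(f²) ≥ 2a² − 2aEf ≥ a² − (Ef)²`.

AT FUNCTION LEVEL.  As in `RestrictedCheegerInequality.lean`, the bounds are typed for every `f`
supported in a set `A` (the variational content of `λ₀(A) ≥ …` / `Λ(r) ≥ …`); the one-line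
restatements through `dirichletEigenvalue` / `spectralProfile` of `SpectralProfile.lean` are left to
that module (value-free TODO).  The tree's Nash inequality of the second kind `NashInequalityT π P
C d T` (`NashInequality.lean`, Saloff-Coste's (2.3.3): `‖g‖₂^{2(1+2/d)} ≤ C(𝓔 + T⁻¹‖g‖₂²)‖g‖₁^{4/d}`)
is the source's hypothesis with `1/D = 4/d`, so the printed `π(A)^{1/2D}` reads `π(A)^{2/d}`.

## Content
* `two_mul_sq_sub_le_sq_mul_log` (`2u² − 2au ≤ u²log(u²/a²)`), `GoelMontenegroTetali2006_sq_sub_sq_le_ent`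
  (weighted: `Σwf² − (Σwf)² ≤ Σ w f² log(f²/Σwf²)`, `w, f ≥ 0`) and **`lawVariance_le_entForm`**
  (**`Var_π(f) ≤ Ent_π(f²)` for `f ≥ 0`**, the [LO00]/[BT03, Remark 6.7] step);
* **LEMMA 4.2 (function level)** `entForm_ge_of_support` (`Ent_π(f²) ≥ [log(1/π(S))/(1 − π(S))]
  Var_π(f)` for `f ≥ 0` supported in `S`, `0 < π(S) < 1`) and `GoelMontenegroTetali2006_lemma_4_2`
  (**`ρ·[log(1/π(S))/(1 − π(S))]·Var_π(f) ≤ 𝓔(f,f)`**);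
* **LEMMA 4.3 (function level)** `lOneNorm_sq_le_of_support` (`‖f‖₁² ≤ π(A)‖f‖₂²`) and
  `GoelMontenegroTetali2006_lemma_4_3` (**`(1/(Cπ(A)^{2/d}) − 1/T)‖f‖₂² ≤ 𝓔(f,f)`**).
-/

namespace Literature.Probability.MarkovChains

open Finset Matrix

variable {X : Type*} [Fintype X] [DecidableEq X] {P : Matrix X X ℝ} {π : X → ℝ}

/-! ## `Var(f) ≤ Ent(f²)` for `f ≥ 0` -/

section EntVar

/-- `2u² − 2au ≤ u² log(u²/a²)` for `u ≥ 0`, `a > 0` (`log(u/a) ≥ 1 − a/u`).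
[cite: GoelMontenegroTetali2006, §4.2 proof of Lemma 4.2 (the step `Ent(f²)/Var(f) ≥ 1`)] -/
theorem two_mul_sq_sub_le_sq_mul_log {u a : ℝ} (hu : 0 ≤ u) (ha : 0 < a) :
    2 * u ^ 2 - 2 * a * u ≤ u ^ 2 * Real.log (u ^ 2 / a ^ 2) := by
  rcases hu.eq_or_lt with h | hu0
  · rw [← h]; simp
  have hua : 0 < u / a := div_pos hu0 ha
  rw [← div_pow, Real.log_pow, Nat.cast_ofNat]
  have h1 : 1 - (u / a)⁻¹ ≤ Real.log (u / a) := Real.one_sub_inv_le_log_of_pos hua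
  rw [inv_div] at h1
  have e : u ^ 2 * (2 * (1 - a / u)) = 2 * u ^ 2 - 2 * a * u := by
    field_simp
  rw [← e]
  exact mul_le_mul_of_nonneg_left (by linarith) (sq_nonneg u)

omit [Fintype X] [DecidableEq X] in
/-- **`Σ_S w f² − (Σ_S w f)² ≤ Σ_S w f² log(f²/Σ_S w f²)`** for weights `w ≥ 0` and `f ≥ 0` on `S`
with `Σ_S w f² > 0` (sum `2u² − 2au ≤ u²log(u²/a²)` with `a² = Σwf²`: the right side is `≥ 2a² −
2aΣwf ≥ a² − (Σwf)²`).  For a probability vector `w` this is `Var_w(f) ≤ Ent_w(f²)`.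
[cite: GoelMontenegroTetali2006, §4.2 proof of Lemma 4.2 ("for every probability measure and
`f ≥ 0` … `Ent(f²)/Var(f) ≥ 1` … [LO00.1] … Remark 6.7 of [BT03.1]"); BobkovTetali2006, Remark 6.7] -/
theorem GoelMontenegroTetali2006_sq_sub_sq_le_ent {S : Finset X} {w f : X → ℝ}
    (hw : ∀ x ∈ S, 0 ≤ w x) (hf : ∀ x ∈ S, 0 ≤ f x) (hA : 0 < ∑ x ∈ S, w x * f x ^ 2) :
    ∑ x ∈ S, w x * f x ^ 2 - (∑ x ∈ S, w x * f x) ^ 2 ≤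
      ∑ x ∈ S, w x * (f x ^ 2 * Real.log (f x ^ 2 / ∑ y ∈ S, w y * f y ^ 2)) := by
  set A := ∑ x ∈ S, w x * f x ^ 2 with hAdef
  set B := ∑ x ∈ S, w x * f x with hBdef
  set a := Real.sqrt A with hadef
  have ha : 0 < a := Real.sqrt_pos.2 hA
  have ha2 : a ^ 2 = A := Real.sq_sqrt hA.le
  have hpt : ∀ x ∈ S, w x * (2 * f x ^ 2 - 2 * a * f x) ≤
      w x * (f x ^ 2 * Real.log (f x ^ 2 / A)) := fun x hx =>
    mul_le_mul_of_nonneg_left (by rw [← ha2]; exact two_mul_sq_sub_le_sq_mul_log (hf x hx) ha)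
      (hw x hx)
  have hsum : ∑ x ∈ S, w x * (2 * f x ^ 2 - 2 * a * f x) = 2 * A - 2 * a * B := by
    rw [hAdef, hBdef, mul_sum, mul_sum, ← sum_sub_distrib]
    exact sum_congr rfl fun x _ => by ring
  have h := sum_le_sum hpt
  rw [hsum] at h
  nlinarith [sq_nonneg (a - B)]

omit [DecidableEq X] in
/-- **`Var_π(f) ≤ Ent_π(f²)` for `f ≥ 0`** and a positive probability vector `π` — the inequality of
Latała–Oleszkiewicz / Bobkov–Tetali (Remark 6.7) invoked in the proof of LEMMA 4.2, in the tree's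
notation `lawVariance π f ≤ entForm π f`. [cite: GoelMontenegroTetali2006, §4.2 proof of Lemma 4.2;
BobkovTetali2006, Remark 6.7] -/
theorem lawVariance_le_entForm (hπ : ∀ x, 0 < π x) (hπ1 : ∑ x, π x = 1) {f : X → ℝ}
    (hf : ∀ x, 0 ≤ f x) : lawVariance π f ≤ entForm π f := by
  by_cases hA : piInner π f f = 0
  · -- then `f = 0`
    have hf0 : ∀ x, f x = 0 := by
      intro x
      have h := (sum_eq_zero_iff_of_nonneg fun y _ =>
        mul_nonneg (hπ y).le (mul_self_nonneg (f y))).1 hA x (mem_univ x)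
      exact mul_self_eq_zero.1 ((mul_eq_zero.1 h).resolve_left (hπ x).ne')
    have e : f = fun _ => (0:ℝ) := funext hf0
    rw [e]; simp [lawVariance, lawMean, entForm]
  have hA' : 0 < ∑ x, π x * f x ^ 2 := by
    have h0 : 0 ≤ piInner π f f := piInner_self_nonneg (fun x => (hπ x).le) f
    have e : piInner π f f = ∑ x, π x * f x ^ 2 := sum_congr rfl fun x _ => by ring
    rw [← e]; exact lt_of_le_of_ne h0 (Ne.symm hA)
  have h := GoelMontenegroTetali2006_sq_sub_sq_le_ent (S := univ) (fun x _ => (hπ x).le)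
    (fun x _ => hf x) hA'
  have hvar : lawVariance π f = ∑ x, π x * f x ^ 2 - (∑ x, π x * f x) ^ 2 := by
    have h2 := piInner_sub_const_eq hπ1 f 0
    simp only [sub_zero] at h2
    have e : piInner π f f = ∑ x, π x * f x ^ 2 := sum_congr rfl fun x _ => by ring
    rw [e] at h2; unfold lawMean at h2; linarith
  have hent : entForm π f = ∑ x, π x * (f x ^ 2 * Real.log (f x ^ 2 / ∑ y, π y * f y ^ 2)) := by
    unfold entForm
    have e : piInner π f f = ∑ y, π y * f y ^ 2 := sum_congr rfl fun y _ => by ring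
    rw [e]
  rw [hvar, hent]; exact h

end EntVar

/-! ## LEMMA 4.2: the Faber–Krahn bound from the log-Sobolev constant -/

section LogSobolev

omit [DecidableEq X] in
/-- **The set-level entropy bound of LEMMA 4.2**: for `f ≥ 0` supported in `S` with `0 < π(S) < 1`,
**`Ent_π(f²) ≥ [log(1/π(S))/(1 − π(S))]·Var_π(f)`** ("`inf_{c₀⁺(S)} Ent_π(f²)/Var_π(f) ≥ log(1/π(S))/
(1 − π(S))`": `Ent_π(f²) = π(S)[Ent_{π'}(f²) + log(1/π(S))E_{π'}f²]`, `Var_π(f) = π(S)[E_{π'}f² −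
π(S)(E_{π'}f)²]`, `Ent_{π'}(f²) ≥ Var_{π'}(f)` and `π(S)log(1/π(S)) ≤ 1 − π(S)`).
[cite: GoelMontenegroTetali2006, §4.2 Lemma 4.2 (proof)] -/
theorem entForm_ge_of_support (hπ : ∀ x, 0 < π x) (hπ1 : ∑ x, π x = 1) {S : Finset X}
    (hS1 : ∑ x ∈ S, π x < 1) {f : X → ℝ} (hf : ∀ x, 0 ≤ f x) (hsupp : ∀ x ∉ S, f x = 0) :
    Real.log (1 / ∑ x ∈ S, π x) / (1 - ∑ x ∈ S, π x) * lawVariance π f ≤ entForm π f := by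
  -- sums over `univ` of quantities vanishing off `S` are sums over `S`
  have hres : ∀ g : X → ℝ, (∀ x ∉ S, g x = 0) → ∑ x, g x = ∑ x ∈ S, g x := fun g hg =>
    (sum_subset (subset_univ S) fun x _ hx => hg x hx).symm
  have hNu : piInner π f f = ∑ x ∈ S, π x * f x ^ 2 := by
    unfold piInner
    rw [hres _ fun x hx => by simp [hsupp x hx]]
    exact sum_congr rfl fun x _ => by ring
  have hvar : lawVariance π f = (∑ x ∈ S, π x * f x ^ 2) - (∑ x ∈ S, π x * f x) ^ 2 := by
    have h2 := piInner_sub_const_eq hπ1 f 0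
    have hm : lawMean π f = ∑ x ∈ S, π x * f x := by
      unfold lawMean; exact hres _ fun x hx => by simp [hsupp x hx]
    simp only [sub_zero] at h2
    rw [hNu, hm] at h2
    linarith
  have hent : entForm π f =
      ∑ x ∈ S, π x * (f x ^ 2 * Real.log (f x ^ 2 / ∑ y ∈ S, π y * f y ^ 2)) := by
    unfold entForm
    rw [hNu]
    exact hres _ fun x hx => by simp [hsupp x hx]
  rw [hvar, hent]
  clear hvar hent hNu
  -- the case `f = 0 on S`
  by_cases hN0 : ∑ x ∈ S, π x * f x ^ 2 = 0
  · have hfS : ∀ x ∈ S, f x = 0 := fun x hx =>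
      pow_eq_zero_iff (n := 2) (by norm_num) |>.1 ((mul_eq_zero.1 ((sum_eq_zero_iff_of_nonneg
        fun y _ => mul_nonneg (hπ y).le (sq_nonneg (f y))).1 hN0 x hx)).resolve_left (hπ x).ne')
    have e1 : ∑ x ∈ S, π x * (f x ^ 2 * Real.log (f x ^ 2 / ∑ y ∈ S, π y * f y ^ 2)) = 0 :=
      sum_eq_zero fun x hx => by simp [hfS x hx]
    have e2 : ∑ x ∈ S, π x * f x = 0 := sum_eq_zero fun x hx => by simp [hfS x hx]
    rw [e1, e2, hN0]
    norm_num
  have hNpos : 0 < ∑ x ∈ S, π x * f x ^ 2 :=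
    lt_of_le_of_ne (sum_nonneg fun x _ => mul_nonneg (hπ x).le (sq_nonneg _)) (Ne.symm hN0)
  have hs0 : 0 < ∑ x ∈ S, π x := by
    obtain ⟨x, hx, hfx⟩ : ∃ x ∈ S, π x * f x ^ 2 ≠ 0 := by
      by_contra h
      exact hN0 (sum_eq_zero fun x hx => Classical.not_not.1 fun hne => h ⟨x, hx, hne⟩)
    exact lt_of_lt_of_le (hπ x) (single_le_sum (fun y _ => (hπ y).le) hx)
  -- name the four scalars
  generalize hN : ∑ x ∈ S, π x * f x ^ 2 = N at hNpos ⊢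
  generalize hm : ∑ x ∈ S, π x * f x = m
  generalize hs : ∑ x ∈ S, π x = s at hS1 hs0 ⊢
  set L := Real.log (1 / s) with hLdef
  have hL0 : 0 ≤ L := Real.log_nonneg ((one_le_div hs0).2 hS1.le)
  have h1s : 0 < 1 - s := by linarith
  -- `Σ_S π f² log(f²/N) = Σ_S π f² log(f²/(N/s)) + L·N`
  have hsplit : ∑ x ∈ S, π x * (f x ^ 2 * Real.log (f x ^ 2 / N)) =
      ∑ x ∈ S, π x * (f x ^ 2 * Real.log (f x ^ 2 / (N / s))) + L * N := by
    have eLN : L * N = ∑ x ∈ S, π x * f x ^ 2 * L := by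
      rw [← hN, mul_sum]; exact sum_congr rfl fun x _ => by ring
    rw [eLN, ← sum_add_distrib]
    refine sum_congr rfl fun x _ => ?_
    by_cases hfx : f x = 0
    · simp [hfx]
    have hf2 : 0 < f x ^ 2 := by positivity
    have e2 : f x ^ 2 / N = f x ^ 2 / (N / s) * (1 / s) := by field_simp
    rw [e2, Real.log_mul (div_pos hf2 (div_pos hNpos hs0)).ne' (by positivity), ← hLdef]
    ring
  -- the [LO00] step with the weights `π/s` on `S`: `Σ_S (π/s) f² log(f²/(N/s)) ≥ N/s − (m/s)²`
  have e1 : ∑ x ∈ S, π x / s * f x ^ 2 = N / s := by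
    rw [← hN, sum_div]; exact sum_congr rfl fun x _ => by ring
  have e2 : ∑ x ∈ S, π x / s * f x = m / s := by
    rw [← hm, sum_div]; exact sum_congr rfl fun x _ => by ring
  have hLO := GoelMontenegroTetali2006_sq_sub_sq_le_ent (S := S) (w := fun x => π x / s) (f := f)
    (fun x _ => div_nonneg (hπ x).le hs0.le) (fun x _ => hf x) (by rw [e1]; exact div_pos hNpos hs0)
  rw [e1, e2] at hLO
  have e3 : ∑ x ∈ S, π x / s * (f x ^ 2 * Real.log (f x ^ 2 / (N / s))) =
      (∑ x ∈ S, π x * (f x ^ 2 * Real.log (f x ^ 2 / (N / s)))) / s := by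
    rw [sum_div]; exact sum_congr rfl fun x _ => by ring
  rw [e3, le_div_iff₀ hs0] at hLO
  -- `hLO : (N/s − (m/s)²)·s ≤ T₁`; `T₁ ≥ 0`-side: `(N/s − (m/s)²)s = (sN − m²)/s ≥ 0` by Cauchy–Schwarz
  have hT1 : 0 ≤ s * N - m ^ 2 := by
    have hcs := sum_mul_sq_le_sq_mul_sq S (fun x => Real.sqrt (π x)) (fun x => Real.sqrt (π x) * f x)
    have q1 : ∀ x ∈ S, Real.sqrt (π x) * (Real.sqrt (π x) * f x) = π x * f x := fun x _ => by
      rw [← mul_assoc, Real.mul_self_sqrt (hπ x).le]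
    have q2 : ∀ x ∈ S, Real.sqrt (π x) ^ 2 = π x := fun x _ => Real.sq_sqrt (hπ x).le
    have q3 : ∀ x ∈ S, (Real.sqrt (π x) * f x) ^ 2 = π x * f x ^ 2 := fun x _ => by
      rw [mul_pow, Real.sq_sqrt (hπ x).le]
    rw [sum_congr rfl q1, sum_congr rfl q2, sum_congr rfl q3, hm, hs, hN] at hcs
    linarith
  -- `c = sL/(1 − s) ≤ 1`, i.e. `sL ≤ 1 − s`
  have hc : s * L ≤ 1 - s := by
    have h := Real.log_le_sub_one_of_pos (one_div_pos.2 hs0)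
    rw [← hLdef] at h
    have := mul_le_mul_of_nonneg_left h hs0.le
    rw [mul_sub, mul_one_div_cancel hs0.ne', mul_one] at this
    exact this
  have e4 : (N / s - (m / s) ^ 2) * s = (s * N - m ^ 2) / s := by field_simp
  rw [e4] at hLO
  -- assemble: `L(N − m²) ≤ (1 − s)(T₁ + LN)` with `T₁ ≥ (sN − m²)/s ≥ (sL/(1−s))(sN − m²)/s`
  rw [hsplit, div_mul_eq_mul_div, div_le_iff₀ h1s]
  have key : s * L * ((s * N - m ^ 2) / s) ≤
      (1 - s) * ∑ x ∈ S, π x * (f x ^ 2 * Real.log (f x ^ 2 / (N / s))) :=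
    (mul_le_mul_of_nonneg_right hc (div_nonneg hT1 hs0.le)).trans
      (mul_le_mul_of_nonneg_left hLO h1s.le)
  have e5 : s * L * ((s * N - m ^ 2) / s) = L * (s * N - m ^ 2) := by field_simp
  rw [e5] at key
  nlinarith [key, hL0, hNpos.le, h1s]

omit [DecidableEq X] in
/-- **LEMMA 4.2 (Goel–Montenegro–Tetali 2006), function level: `λ₀(S) ≥ Λ(π(S))`-type bound
`𝓔(f,f) ≥ ρ·[log(1/π(S))/(1 − π(S))]·Var_π(f)`** for every `f ≥ 0` supported in `S`, `0 < π(S) <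
1`, where `ρ = logSobolevConst π K` (so `Λ(r) ≥ ρ log(1/r)/(1 − r)`).  `K ≥ 0` entrywise, `π` a
positive probability vector. [cite: GoelMontenegroTetali2006, §4.2 Lemma 4.2] -/
theorem GoelMontenegroTetali2006_lemma_4_2 (hπ : ∀ x, 0 < π x) (hπ1 : ∑ x, π x = 1)
    (hP0 : ∀ x y, 0 ≤ P x y) {S : Finset X} (hS1 : ∑ x ∈ S, π x < 1) {f : X → ℝ}
    (hf : ∀ x, 0 ≤ f x) (hsupp : ∀ x ∉ S, f x = 0) :
    logSobolevConst π P * (Real.log (1 / ∑ x ∈ S, π x) / (1 - ∑ x ∈ S, π x)) * lawVariance π f ≤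
      dirichletForm π P f := by
  rw [mul_assoc]
  exact (mul_le_mul_of_nonneg_left (entForm_ge_of_support hπ hπ1 hS1 hf hsupp)
    (logSobolevConst_nonneg hπ hπ1 hP0)).trans (logSobolevConst_mul_entForm_le hπ hπ1 hP0 f)

end LogSobolev

/-! ## LEMMA 4.3: the Faber–Krahn bound from a Nash inequality -/

section Nash

omit [DecidableEq X] in
/-- **Cauchy–Schwarz on the support: `‖f‖₁² ≤ π(supp f)·‖f‖₂²`**, here `‖f‖₁² ≤ π(A)⟨f,f⟩_π` for `f`
vanishing off `A` (`π ≥ 0`). [cite: GoelMontenegroTetali2006, §4.2 proof of Lemma 4.3 ("The final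
inequality was due to Cauchy-Schwartz: `‖f‖₁ ≤ ‖f‖₂√π(supp f)`")] -/
theorem lOneNorm_sq_le_of_support (hπ0 : ∀ x, 0 ≤ π x) {A : Finset X} {f : X → ℝ}
    (hsupp : ∀ x ∉ A, f x = 0) : lOneNorm π f ^ 2 ≤ (∑ x ∈ A, π x) * piInner π f f := by
  have hres : lOneNorm π f = ∑ x ∈ A, π x * |f x| :=
    (sum_subset (subset_univ A) fun x _ hx => by simp [hsupp x hx]).symm
  have hcs := sum_mul_sq_le_sq_mul_sq A (fun x => Real.sqrt (π x)) (fun x => Real.sqrt (π x) * |f x|)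
  have q1 : ∀ x ∈ A, Real.sqrt (π x) * (Real.sqrt (π x) * |f x|) = π x * |f x| := fun x _ => by
    rw [← mul_assoc, Real.mul_self_sqrt (hπ0 x)]
  have q2 : ∀ x ∈ A, Real.sqrt (π x) ^ 2 = π x := fun x _ => Real.sq_sqrt (hπ0 x)
  have q3 : ∀ x ∈ A, (Real.sqrt (π x) * |f x|) ^ 2 = π x * (f x * f x) := fun x _ => by
    rw [mul_pow, Real.sq_sqrt (hπ0 x), sq_abs, sq]
  rw [sum_congr rfl q1, sum_congr rfl q2, sum_congr rfl q3, ← hres] at hcs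
  refine hcs.trans (mul_le_mul_of_nonneg_left ?_ (sum_nonneg fun x _ => hπ0 x))
  exact sum_le_sum_of_subset_of_nonneg (subset_univ A) fun x _ _ =>
    mul_nonneg (hπ0 x) (mul_self_nonneg _)

omit [DecidableEq X] in
/-- **LEMMA 4.3 (Goel–Montenegro–Tetali 2006), function level: `λ₀(A) ≥ 1/(Cπ(A)^{2/d}) − 1/T`.**
Under the Nash inequality `NashInequalityT π K C d T` (`C, d, T > 0`), for every `f` supported in `A`
(`π(A) > 0`): **`(1/(Cπ(A)^{2/d}) − 1/T)·‖f‖₂² ≤ 𝓔(f,f)`** ("`𝓔/‖f‖₂² ≥ (1/C)(‖f‖₂/‖f‖₁)^{1/D} − 1/T ≥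
1/(Cπ(A)^{1/2D}) − 1/T`", `1/D = 4/d`; so `Λ(r) ≥ 1/(Cr^{2/d}) − 1/T`).  `K ≥ 0` entrywise, `π > 0`.
[cite: GoelMontenegroTetali2006, §4.2 Lemma 4.3] -/
theorem GoelMontenegroTetali2006_lemma_4_3 (hπ : ∀ x, 0 < π x) (hP0 : ∀ x y, 0 ≤ P x y)
    {C d T : ℝ} (hC : 0 < C) (hd : 0 < d) (hT : 0 < T) (hN : NashInequalityT π P C d T)
    {A : Finset X} (hA : 0 < ∑ x ∈ A, π x) {f : X → ℝ} (hsupp : ∀ x ∉ A, f x = 0) :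
    (1 / (C * (∑ x ∈ A, π x) ^ (2 / d)) - T⁻¹) * piInner π f f ≤ dirichletForm π P f := by
  have hπ0 : ∀ x, 0 ≤ π x := fun x => (hπ x).le
  have hE0 : 0 ≤ dirichletForm π P f := dirichletForm_nonneg hπ0 hP0 f
  set N := piInner π f f with hNdef
  have hN0 : 0 ≤ N := piInner_self_nonneg hπ0 f
  rcases hN0.eq_or_lt with hN | hNpos
  · rw [← hN, mul_zero]; exact hE0
  set s := ∑ x ∈ A, π x with hsdef
  have hsd : 0 < s ^ (2 / d) := Real.rpow_pos_of_pos hA _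
  have h2d : 0 ≤ 2 / d := by positivity
  -- Nash: `N^{1+2/d} ≤ C(𝓔 + N/T)‖f‖₁^{4/d} ≤ C(𝓔 + N/T)(sN)^{2/d}`
  have h1 := hN f
  rw [← hNdef] at h1
  have hL : lOneNorm π f ^ (4 / d) ≤ (s * N) ^ (2 / d) := by
    rw [show (4:ℝ) / d = 2 * (2 / d) by ring, Real.rpow_mul (lOneNorm_nonneg hπ0 f)]
    exact Real.rpow_le_rpow (Real.rpow_nonneg (lOneNorm_nonneg hπ0 f) _) (by
      rw [Real.rpow_two]; exact lOneNorm_sq_le_of_support hπ0 hsupp) h2d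
  have hfac : 0 ≤ C * (dirichletForm π P f + T⁻¹ * N) :=
    mul_nonneg hC.le (add_nonneg hE0 (mul_nonneg (inv_nonneg.2 hT.le) hN0))
  have h2 : N ^ (1 + 2 / d) ≤ C * (dirichletForm π P f + T⁻¹ * N) * (s ^ (2 / d) * N ^ (2 / d)) := by
    refine h1.trans ?_
    rw [← Real.mul_rpow hA.le hN0]
    exact mul_le_mul_of_nonneg_left hL hfac
  rw [Real.rpow_add hNpos, Real.rpow_one] at h2
  -- divide by `N^{2/d} > 0`
  have hNd : 0 < N ^ (2 / d) := Real.rpow_pos_of_pos hNpos _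
  have h3 : N ≤ C * (dirichletForm π P f + T⁻¹ * N) * s ^ (2 / d) := by
    refine le_of_mul_le_mul_right ?_ hNd
    calc N * N ^ (2 / d) ≤ C * (dirichletForm π P f + T⁻¹ * N) * (s ^ (2 / d) * N ^ (2 / d)) := h2
      _ = C * (dirichletForm π P f + T⁻¹ * N) * s ^ (2 / d) * N ^ (2 / d) := by ring
  have hM : 0 < C * s ^ (2 / d) := mul_pos hC hsd
  have h4 : N / (C * s ^ (2 / d)) ≤ dirichletForm π P f + T⁻¹ * N := by
    rw [div_le_iff₀ hM]
    linarith [h3, (by ring : C * (dirichletForm π P f + T⁻¹ * N) * s ^ (2 / d) =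
      (dirichletForm π P f + T⁻¹ * N) * (C * s ^ (2 / d)))]
  have e : (1 / (C * s ^ (2 / d)) - T⁻¹) * N = N / (C * s ^ (2 / d)) - T⁻¹ * N := by ring
  rw [e]; linarith

end Nash

end Literature.Probability.MarkovChains
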